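import Summits.Parity.BatemanHorn.Theorems.SoloInformedSmoothHyperbola

/-!
# The smooth located count on `ℤ/e`: one Abel summation into SHIFTED Hooley sums

Informed soloist `solo-Parity-informed` (session 142), conjunct `BatemanHorn`, the `d ≥ 3` rung BELOW the parity
wall; sequel to `SoloInformedSmoothHyperbola` (the exact split `S_g(x) = 2·Small^w_g(x) + 2·Mid^w_g(x)`).

Contents (all EXACT finite algebra; `g ≠ 0` on `[1, x]`, `E ≥ max_{n≤x}|g(n)|`):
* `sum_weightKernel_mul_charSum_eq`: the weighted counting identity on `ℤ/q`,
  `∑_{h<q} (∑_{m∈B} c(m)e(−hm/q))·(∑_{ν∈A} e(hν/q)) = q·∑_{ν∈A∩B} c(ν)` (`A, B ⊆ [0, q)`).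
* `smoothKernel g Δ x e h = Φ_e(h) = ∑_{m≤x} a_e(m)·e(−hm/e)`, `a_e(m) = locWeight g Δ e m = w_Δ(e/√|g(m)|)`, and
  THE EXACT BILINEAR IDENTITY `polySmoothMid_sub_heur_eq`:
  `Mid^w_g(x) − H^w_g(x; E) = ∑_{x<e≤E} (1/e)·∑_{0<h<e} Φ_e(h)·S_g(h; e)`.
* ONE ABEL SUMMATION IN `m` (`sum_Icc_mul_pow_mul_sub_one`, `smoothKernel_mul_sub_one`): with `z = e(−h/e)`,
  `Φ_e(h)·(z − 1) = a_e(x)·z^{x+1} − a_e(1)·z − ∑_{1≤m<x} (a_e(m+1) − a_e(m))·z^{m+1}`.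
  Every phase `z^b·S_g(h; e) = e(−hb/e)·S_g(h; e)` is the Hooley sum of the SHIFTED polynomial `g(X + b)`
  (its roots mod `e` are `ν − b`): `hooleySumShift g e h b` (`S^{(b)}_g(h; e)`), `norm_hooleySumShift_le`.
* THE EXACT TRILINEAR IDENTITY `polySmoothMid_sub_heur_eq_shift`:
  `Mid^w_g(x) − H^w_g(x; E) = ∑_{x<e≤E} ∑_{0<h<e} κ_e(h)·[a_e(x)·S^{(x+1)}_g(h;e) − a_e(1)·S^{(1)}_g(h;e)
     − ∑_{1≤m<x} (a_e(m+1) − a_e(m))·S^{(m+1)}_g(h;e)]`, `κ_e(h) = 1/(e·(e(−h/e) − 1))`,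
  with `|κ_e(h)| ≤ 1/(4·min(h, e−h))` (`norm_modulusWeight_le`) and `0 ≤ a_e(m+1) − a_e(m) ≤ log(|g(m+1)|/|g(m)|)/(4Δ)`
  when `|g(m)| ≤ |g(m+1)|` (`locWeight_sub_le`): after the Abel step EVERY weight is a boundary phase, the
  `m`-differences are `O(1/(Δm))` and, as functions of `e`, are supported on `e ∈ (e^{−Δ}√|g(m)|, e^{Δ}√|g(m+1)|]`
  (`locWeight_sub_eq_zero_of_le`, `locWeight_sub_eq_zero_of_ge`) — `O(1)` dyadic blocks at the scale `√|g(m)|`.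

WHAT THIS TYPES (informal; NOT proved here, recorded for the annex).  Fold `0 < h < e` to `0 < |h| ≤ e/2` (all
three factors are `e`-periodic in `h`; then `|κ_e(h)| ≤ 1/(4|h|)` and `e ↦ κ_e(h)` has total variation `O(1/|h|)` on
`e ≥ 2|h|`), regroup with `h` outside and sum by parts in `e`.  If for some `η` and `C` the SHIFTED HOOLEY SUMS save a
power uniformly — `|∑_{E<e≤E'} S^{(b)}_g(h; e)| ≤ C·E^{1−η}` for all `1 ≤ E < E' ≤ 2E`, all `0 < |h| ≤ E` and all
shifts `0 ≤ b ≤ 2E` — then the display is `≪_{g,Δ,η} x^{(d/2)(1−η)}·log x` (the `a_e(x)` term: dyadic blocks from `x`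
to `x^{d/2}`, harmonic sum in `h`; the `m`-terms: `∑_m (1/m)·(m^{d/2})^{1−η}·log m`), which is `o(x log x)` iff
`η > 1 − 2/d`; with `Mid_g − Mid^w_g = O(x)` and `H_g − H^w_g = O(x)` (elementary, sequel) this gives
`WindowRootEquidistribution g`, i.e. Erdős's `S_g(x) ~ d·A_g·x log x` (`SoloInformedLocatedHeuristic`).  HONEST RANGE:
square-root cancellation is `η = 1/2`, so the implication has content exactly for `d = 3` (needs `η > 1/3`); for
`d ≥ 4` no saving in the modulus sum alone reaches `η > 1 − 2/d ≥ 1/2`, and joint cancellation in `(h, e)` or `(m, e)`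
would be required.  Literature: Hooley (Mathematika 11 (1964)) gives `∑_{e≤E} S_g(h; e) = o(E)` at FIXED `h ≠ 0`
for irreducible `g` (any degree); Kowalski–Soundararajan (Adv. Math. 385 (2021), §2.2) the same with smooth
weights; power savings uniform in `h` are known only for `d = 2` (Hooley 1963, Duke–Friedlander–Iwaniec 1995,
Tóth 2000, via the Gauss correspondence).  Nothing here moves a wall row; verdict NO PATH unchanged.
-/

namespace Summit.Parity.BatemanHorn.Theorems

open Finset Polynomial
open Literature.NumberTheory.Sieve (polyRootCountMod)

/-! ### Characters: two more facts -/

/-- `e(k/q) = 1 ↔ q ∣ k` (`q ≠ 0`). [folklore] -/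
theorem eAdd_eq_one_iff {q : ℕ} (hq : q ≠ 0) (k : ℤ) : eAdd q k = 1 ↔ (q : ℤ) ∣ k := by
  rw [eAdd_eq_zpow]
  exact (Complex.isPrimitiveRoot_exp q hq).zpow_eq_one_iff_dvd k

/-- Periodicity `e((k + qt)/q) = e(k/q)`. [folklore] -/
theorem eAdd_add_modulus_mul (q : ℕ) (k t : ℤ) : eAdd q (k + q * t) = eAdd q k := by
  rcases Nat.eq_zero_or_pos q with rfl | hq
  · simp [eAdd]
  rw [eAdd_add]
  have h1 : eAdd q (q * t) = 1 := (eAdd_eq_one_iff hq.ne' _).mpr (dvd_mul_right _ _)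
  rw [h1, mul_one]

/-! ### The weighted counting identity and the smooth kernel -/

/-- **Weighted finite Fourier counting on `ℤ/q`**: for `A, B ⊆ [0, q)` and weights `c`,
`∑_{h<q} (∑_{m∈B} c(m)·e(−hm/q))·(∑_{ν∈A} e(hν/q)) = q·∑_{ν ∈ A∩B} c(ν)`. [folklore] -/
theorem sum_weightKernel_mul_charSum_eq {q : ℕ} {A B : Finset ℕ} (c : ℕ → ℂ)
    (hA : ∀ ν ∈ A, ν < q) (hB : ∀ m ∈ B, m < q) :
    ∑ h ∈ range q, (∑ m ∈ B, c m * eAdd q (-(h * m))) * (∑ ν ∈ A, eAdd q (h * ν))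
      = (q : ℂ) * ∑ ν ∈ A ∩ B, c ν := by
  calc ∑ h ∈ range q, (∑ m ∈ B, c m * eAdd q (-(h * m))) * (∑ ν ∈ A, eAdd q (h * ν))
      = ∑ h ∈ range q, ∑ m ∈ B, ∑ ν ∈ A, c m * eAdd q (h * ((ν : ℤ) - m)) := by
        refine sum_congr rfl fun h _ => ?_
        rw [sum_mul_sum]
        refine sum_congr rfl fun m _ => sum_congr rfl fun ν _ => ?_
        rw [mul_assoc, ← eAdd_add]
        congr 2
        ring
    _ = ∑ m ∈ B, ∑ ν ∈ A, c m * ∑ h ∈ range q, eAdd q (h * ((ν : ℤ) - m)) := by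
        rw [sum_comm]
        refine sum_congr rfl fun m _ => ?_
        rw [sum_comm]
        exact sum_congr rfl fun ν _ => by rw [mul_sum]
    _ = ∑ m ∈ B, ∑ ν ∈ A, c m * (if ν = m then (q : ℂ) else 0) := by
        refine sum_congr rfl fun m hm => sum_congr rfl fun ν hν => ?_
        rw [sum_range_eAdd_mul]
        congr 1
        exact if_congr (int_dvd_sub_iff_eq_of_lt (hB m hm) (hA ν hν)) rfl rfl
    _ = ∑ m ∈ B, if m ∈ A then c m * (q : ℂ) else 0 := by
        refine sum_congr rfl fun m _ => ?_
        simp_rw [mul_ite, mul_zero]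
        rw [sum_ite_eq']
    _ = (q : ℂ) * ∑ ν ∈ A ∩ B, c ν := by
        rw [← sum_filter, filter_mem_eq_inter, inter_comm, mul_sum]
        exact sum_congr rfl fun ν _ => mul_comm _ _

/-- The SMOOTH KERNEL `Φ_e(h) = ∑_{1≤m≤x} a_e(m)·e(−hm/e)` (the finite Fourier transform on `ℤ/e` of the located
weight `m ↦ w_Δ(e/√|g(m)|)` on `[1, x]`). [this work] -/
noncomputable def smoothKernel (g : ℤ[X]) (Δ : ℝ) (x e : ℕ) (h : ℤ) : ℂ :=
  ∑ m ∈ Icc 1 x, (locWeight g Δ e m : ℂ) * eAdd e (-(h * m))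

/-- `Φ_e(0) = ∑_{m≤x} a_e(m)`. [this work] -/
theorem smoothKernel_zero (g : ℤ[X]) (Δ : ℝ) (x e : ℕ) :
    smoothKernel g Δ x e 0 = ((∑ m ∈ Icc 1 x, locWeight g Δ e m : ℝ) : ℂ) := by
  unfold smoothKernel
  push_cast
  refine sum_congr rfl fun m _ => ?_
  rw [zero_mul, neg_zero, eAdd_zero, mul_one]

/-- The trivial bound `|Φ_e(h)| ≤ ∑_{m≤x} a_e(m) ≤ x`. [this work] -/
theorem norm_smoothKernel_le (g : ℤ[X]) (Δ : ℝ) (x e : ℕ) (h : ℤ) :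
    ‖smoothKernel g Δ x e h‖ ≤ ∑ m ∈ Icc 1 x, locWeight g Δ e m := by
  unfold smoothKernel
  refine (norm_sum_le _ _).trans (sum_le_sum fun m _ => ?_)
  rw [norm_mul, norm_eAdd, mul_one, Complex.norm_real, Real.norm_eq_abs, abs_of_nonneg (locWeight_nonneg _ _ _ _)]

/-- **EXACT IDENTITY — the smooth located discrepancy is a bilinear form in Hooley sums**:
`Mid^w_g(x) − H^w_g(x; E) = ∑_{x<e≤E} (1/e)·∑_{0<h<e} Φ_e(h)·S_g(h; e)`. [this work] -/
theorem polySmoothMid_sub_heur_eq (g : ℤ[X]) (Δ : ℝ) {x E : ℕ} (hg0 : ∀ n ∈ Icc 1 x, g.eval (n : ℤ) ≠ 0)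
    (hE : ∀ n ∈ Icc 1 x, (g.eval (n : ℤ)).natAbs ≤ E) :
    ((polySmoothMid g Δ x : ℝ) : ℂ) - ((polySmoothHeur g Δ x E : ℝ) : ℂ)
      = ∑ e ∈ Ioc x E, (1 / (e : ℂ)) * ∑ h ∈ Ico 1 e, smoothKernel g Δ x e h * hooleySum g e h := by
  rw [polySmoothMid_eq_sum g Δ hg0 hE, polySmoothHeur]
  push_cast
  rw [← sum_sub_distrib]
  refine sum_congr rfl fun e he => ?_
  have hxe : x < e := (mem_Ioc.mp he).1
  have he0' : 0 < e := by omega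
  have he0 : (e : ℂ) ≠ 0 := by exact_mod_cast he0'.ne'
  have hB : ∀ m ∈ Icc 1 x, m < e := fun m hm => (mem_Icc.mp hm).2.trans_lt hxe
  have hid := sum_weightKernel_mul_charSum_eq (fun m => (locWeight g Δ e m : ℂ)) (rootResidues_lt g e) hB
  rw [range_eq_Ico, sum_eq_sum_Ico_succ_bot he0'] at hid
  simp only [Nat.cast_zero, zero_mul, neg_zero, eAdd_zero, mul_one, sum_const, nsmul_eq_mul, mul_one,
    card_rootResidues] at hid
  have hid' : ∑ h ∈ Ico 1 e, smoothKernel g Δ x e h * hooleySum g e h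
      = (e : ℂ) * ∑ ν ∈ rootResidues g e ∩ Icc 1 x, (locWeight g Δ e ν : ℂ)
        - (∑ m ∈ Icc 1 x, (locWeight g Δ e m : ℂ)) * polyRootCountMod ![g] e := by
    rw [← hid]
    unfold smoothKernel hooleySum
    ring
  rw [hid']
  push_cast
  field_simp

/-! ### One Abel summation in `m` -/

/-- **Abel summation** against a geometric progression: for `x ≥ 1`,
`(∑_{1≤m≤x} a(m)z^m)·(z − 1) = a(x)z^{x+1} − a(1)z − ∑_{1≤m<x} (a(m+1) − a(m))·z^{m+1}`. [folklore] -/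
theorem sum_Icc_mul_pow_mul_sub_one (a : ℕ → ℂ) (z : ℂ) {x : ℕ} (hx : 1 ≤ x) :
    (∑ m ∈ Icc 1 x, a m * z ^ m) * (z - 1)
      = a x * z ^ (x + 1) - a 1 * z - ∑ m ∈ Ico 1 x, (a (m + 1) - a m) * z ^ (m + 1) := by
  induction x, hx using Nat.le_induction with
  | base => simp
            ring
  | succ k hk ih =>
      rw [sum_Icc_succ_top (by omega : 1 ≤ k + 1), add_mul, ih, sum_Ico_succ_top hk]
      ring

/-- `e(−hm/e) = e(−h/e)^m`. [folklore] -/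
theorem eAdd_neg_mul_nat (e : ℕ) (h : ℤ) (m : ℕ) : eAdd e (-(h * m)) = eAdd e (-h) ^ m := by
  rw [← eAdd_nat_mul]
  congr 1
  ring

/-- **The smooth kernel after one Abel summation**: with `z = e(−h/e)`,
`Φ_e(h)·(z − 1) = a_e(x)·e(−h(x+1)/e) − a_e(1)·e(−h/e) − ∑_{1≤m<x} (a_e(m+1) − a_e(m))·e(−h(m+1)/e)`. [this work] -/
theorem smoothKernel_mul_sub_one (g : ℤ[X]) (Δ : ℝ) {x : ℕ} (hx : 1 ≤ x) (e : ℕ) (h : ℤ) :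
    smoothKernel g Δ x e h * (eAdd e (-h) - 1)
      = (locWeight g Δ e x : ℂ) * eAdd e (-(h * ((x : ℤ) + 1))) - (locWeight g Δ e 1 : ℂ) * eAdd e (-h)
        - ∑ m ∈ Ico 1 x, ((locWeight g Δ e (m + 1) - locWeight g Δ e m : ℝ) : ℂ)
            * eAdd e (-(h * ((m : ℤ) + 1))) := by
  have hker : smoothKernel g Δ x e h = ∑ m ∈ Icc 1 x, (locWeight g Δ e m : ℂ) * eAdd e (-h) ^ m := by
    unfold smoothKernel
    exact sum_congr rfl fun m _ => by rw [eAdd_neg_mul_nat]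
  rw [hker, sum_Icc_mul_pow_mul_sub_one (fun m => (locWeight g Δ e m : ℂ)) (eAdd e (-h)) hx]
  have hp : ∀ m : ℕ, eAdd e (-h) ^ (m + 1) = eAdd e (-(h * ((m : ℤ) + 1))) := by
    intro m
    rw [← eAdd_neg_mul_nat e h (m + 1)]
    push_cast
    ring_nf
  simp only [hp]
  push_cast
  ring

/-! ### Shifted Hooley sums -/

/-- The SHIFTED (twisted) Hooley sum `S^{(b)}_g(h; e) = e(−hb/e)·S_g(h; e) = ∑_{ν root of g mod e} e(h(ν − b)/e)`,
i.e. the Hooley sum of the shifted polynomial `g(X + b)` (whose roots mod `e` are the `ν − b`). [this work] -/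
noncomputable def hooleySumShift (g : ℤ[X]) (e : ℕ) (h b : ℤ) : ℂ :=
  eAdd e (-(h * b)) * hooleySum g e h

/-- `S^{(0)}_g = S_g`. [this work] -/
theorem hooleySumShift_zero (g : ℤ[X]) (e : ℕ) (h : ℤ) : hooleySumShift g e h 0 = hooleySum g e h := by
  rw [hooleySumShift, mul_zero, neg_zero, eAdd_zero, one_mul]

/-- `S^{(b)}_g(h; e) = ∑_{ν root mod e} e(h(ν − b)/e)`. [this work] -/
theorem hooleySumShift_eq_sum (g : ℤ[X]) (e : ℕ) (h b : ℤ) :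
    hooleySumShift g e h b = ∑ ν ∈ rootResidues g e, eAdd e (h * ((ν : ℤ) - b)) := by
  rw [hooleySumShift, hooleySum, mul_sum]
  refine sum_congr rfl fun ν _ => ?_
  rw [← eAdd_add]
  congr 1
  ring

/-- The trivial bound `|S^{(b)}_g(h; e)| ≤ ρ_g(e)`. [this work] -/
theorem norm_hooleySumShift_le (g : ℤ[X]) (e : ℕ) (h b : ℤ) :
    ‖hooleySumShift g e h b‖ ≤ polyRootCountMod ![g] e := by
  rw [hooleySumShift, norm_mul, norm_eAdd, one_mul]
  exact norm_hooleySum_le g e h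

/-- The shift is `e`-periodic in `b`. [this work] -/
theorem hooleySumShift_add_modulus (g : ℤ[X]) (e : ℕ) (h b : ℤ) :
    hooleySumShift g e h (b + e) = hooleySumShift g e h b := by
  rw [hooleySumShift, hooleySumShift, show -(h * (b + e)) = -(h * b) + e * (-h) by ring, eAdd_add_modulus_mul]

/-! ### The modulus weight `κ_e(h)` and the exact trilinear identity -/

/-- `e(−h/e) ≠ 1` for `0 < h < e`. [folklore] -/
theorem eAdd_neg_ne_one {e h : ℕ} (h0 : 0 < h) (he : h < e) : eAdd e (-(h : ℤ)) ≠ 1 := by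
  rw [Ne, eAdd_eq_one_iff (by omega) (-(h : ℤ)), dvd_neg]
  intro hd
  have := Int.le_of_dvd (by exact_mod_cast h0) hd
  omega

/-- **The modulus weight is `≤ 1/(4 min(h, e−h))`**: `|1/(e·(e(−h/e) − 1))| ≤ 1/(4·min(h, e−h))` for `0 < h < e`
(`|e(−h/e) − 1| = 2|sin(πh/e)| ≥ 4·min(h, e−h)/e`, Jordan). [this work] -/
theorem norm_modulusWeight_le {e h : ℕ} (h0 : 0 < h) (he : h < e) :
    ‖1 / ((e : ℂ) * (eAdd e (-(h : ℤ)) - 1))‖ ≤ 1 / (4 * ((min h (e - h) : ℕ) : ℝ)) := by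
  have hmin : 0 < min h (e - h) := lt_min h0 (by omega)
  have hminR : (0 : ℝ) < ((min h (e - h) : ℕ) : ℝ) := by exact_mod_cast hmin
  have hepos : (0 : ℝ) < e := by exact_mod_cast (h0.trans he)
  have hsin := two_mul_min_div_le_abs_sin h0 he
  have hnorm : ‖(e : ℂ) * (eAdd e (-(h : ℤ)) - 1)‖ = (e : ℝ) * (2 * |Real.sin (Real.pi * h / e)|) := by
    rw [norm_mul, Complex.norm_natCast, norm_eAdd_neg_sub_one]
    push_cast
    ring_nf
  have hlow : 4 * ((min h (e - h) : ℕ) : ℝ) ≤ ‖(e : ℂ) * (eAdd e (-(h : ℤ)) - 1)‖ := by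
    rw [hnorm]
    have : 4 * ((min h (e - h) : ℕ) : ℝ) = (e : ℝ) * (2 * (2 * ((min h (e - h) : ℕ) : ℝ) / e)) := by
      field_simp
      ring
    rw [this]
    exact mul_le_mul_of_nonneg_left (mul_le_mul_of_nonneg_left hsin (by norm_num)) hepos.le
  rw [norm_div, norm_one]
  exact one_div_le_one_div_of_le (by positivity) hlow

/-- **THE EXACT TRILINEAR IDENTITY** (one Abel summation in `m`; `x ≥ 1`, `g ≠ 0` on `[1, x]`, `E ≥ max|g(n)|`):
`Mid^w_g(x) − H^w_g(x; E) = ∑_{x<e≤E} ∑_{0<h<e} κ_e(h)·[a_e(x)·S^{(x+1)}_g(h;e) − a_e(1)·S^{(1)}_g(h;e)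
   − ∑_{1≤m<x} (a_e(m+1) − a_e(m))·S^{(m+1)}_g(h;e)]`, `κ_e(h) = 1/(e·(e(−h/e) − 1))`: after the Abel step every
weight of the located root count is a boundary phase, i.e. a SHIFT of the Hooley sum. [this work] -/
theorem polySmoothMid_sub_heur_eq_shift (g : ℤ[X]) (Δ : ℝ) {x E : ℕ} (hx : 1 ≤ x)
    (hg0 : ∀ n ∈ Icc 1 x, g.eval (n : ℤ) ≠ 0) (hE : ∀ n ∈ Icc 1 x, (g.eval (n : ℤ)).natAbs ≤ E) :
    ((polySmoothMid g Δ x : ℝ) : ℂ) - ((polySmoothHeur g Δ x E : ℝ) : ℂ)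
      = ∑ e ∈ Ioc x E, ∑ h ∈ Ico 1 e, (1 / ((e : ℂ) * (eAdd e (-(h : ℤ)) - 1)))
          * ((locWeight g Δ e x : ℂ) * hooleySumShift g e h ((x : ℤ) + 1)
              - (locWeight g Δ e 1 : ℂ) * hooleySumShift g e h 1
              - ∑ m ∈ Ico 1 x, ((locWeight g Δ e (m + 1) - locWeight g Δ e m : ℝ) : ℂ)
                  * hooleySumShift g e h ((m : ℤ) + 1)) := by
  rw [polySmoothMid_sub_heur_eq g Δ hg0 hE]
  refine sum_congr rfl fun e he => ?_
  have hxe : x < e := (mem_Ioc.mp he).1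
  have he0 : (e : ℂ) ≠ 0 := by exact_mod_cast (show e ≠ 0 by omega)
  rw [mul_sum]
  refine sum_congr rfl fun h hh => ?_
  rw [mem_Ico] at hh
  have hz : eAdd e (-(h : ℤ)) - 1 ≠ 0 := sub_ne_zero.mpr (eAdd_neg_ne_one hh.1 hh.2)
  have hk : smoothKernel g Δ x e h
      = (1 / (eAdd e (-(h : ℤ)) - 1)) * (smoothKernel g Δ x e h * (eAdd e (-(h : ℤ)) - 1)) := by
    field_simp
  rw [hk, smoothKernel_mul_sub_one g Δ hx e h]
  have hsum : ∑ m ∈ Ico 1 x, ((locWeight g Δ e (m + 1) - locWeight g Δ e m : ℝ) : ℂ)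
        * hooleySumShift g e h ((m : ℤ) + 1)
      = (∑ m ∈ Ico 1 x, ((locWeight g Δ e (m + 1) - locWeight g Δ e m : ℝ) : ℂ)
          * eAdd e (-(h * ((m : ℤ) + 1)))) * hooleySum g e h := by
    rw [sum_mul]
    exact sum_congr rfl fun m _ => by rw [hooleySumShift, mul_assoc]
  rw [hsum]
  simp only [hooleySumShift, mul_one]
  generalize (∑ m ∈ Ico 1 x, ((locWeight g Δ e (m + 1) - locWeight g Δ e m : ℝ) : ℂ)
      * eAdd e (-(h * ((m : ℤ) + 1)))) = T
  field_simp

/-! ### The `m`-differences of the located weight -/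

/-- The located weight is nondecreasing in `m` where `|g|` is: `a_e(m) ≤ a_e(m')` if `|g(m)| ≤ |g(m')|`,
`g(m) ≠ 0` (`Δ > 0`). [this work] -/
theorem locWeight_mono (g : ℤ[X]) {Δ : ℝ} (hΔ : 0 < Δ) (e : ℕ) {m m' : ℕ} (hm : g.eval (m : ℤ) ≠ 0)
    (hle : (g.eval (m : ℤ)).natAbs ≤ (g.eval (m' : ℤ)).natAbs) :
    locWeight g Δ e m ≤ locWeight g Δ e m' := by
  unfold locWeight
  rcases Nat.eq_zero_or_pos e with rfl | he
  · simp
  have hs : sqrtAbsEval g m ≤ sqrtAbsEval g m' := Real.sqrt_le_sqrt (by exact_mod_cast hle)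
  have hspos : 0 < sqrtAbsEval g m := sqrtAbsEval_pos g hm
  have hepos : (0 : ℝ) < e := by exact_mod_cast he
  exact hypWeight_antitone hΔ (div_pos hepos (hspos.trans_le hs))
    (div_le_div_of_nonneg_left hepos.le hspos hs)

/-- **The `m`-differences are `O(1/(Δm))`**: `|a_e(m') − a_e(m)| ≤ |log|g(m')| − log|g(m)||/(4Δ)`
(`g(m), g(m') ≠ 0`, `Δ > 0`; for a polynomial `log|g(m+1)| − log|g(m)| = d/m + O(1/m²)`). [this work] -/
theorem abs_locWeight_sub_le (g : ℤ[X]) {Δ : ℝ} (hΔ : 0 < Δ) (e : ℕ) {m m' : ℕ} (hm : g.eval (m : ℤ) ≠ 0)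
    (hm' : g.eval (m' : ℤ) ≠ 0) :
    |locWeight g Δ e m' - locWeight g Δ e m|
      ≤ |Real.log ((g.eval (m' : ℤ)).natAbs : ℝ) - Real.log ((g.eval (m : ℤ)).natAbs : ℝ)| / (4 * Δ) := by
  unfold locWeight
  rcases Nat.eq_zero_or_pos e with rfl | he
  · simp only [CharP.cast_eq_zero, zero_div, sub_self, abs_zero]
    positivity
  have hepos : (0 : ℝ) < e := by exact_mod_cast he
  have hs := sqrtAbsEval_pos g hm
  have hs' := sqrtAbsEval_pos g hm'
  refine (abs_hypWeight_sub_le hΔ _ _).trans (le_of_eq ?_)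
  have hN : (0 : ℝ) < ((g.eval (m : ℤ)).natAbs : ℝ) := by
    exact_mod_cast Nat.pos_of_ne_zero (Int.natAbs_ne_zero.mpr hm)
  have hN' : (0 : ℝ) < ((g.eval (m' : ℤ)).natAbs : ℝ) := by
    exact_mod_cast Nat.pos_of_ne_zero (Int.natAbs_ne_zero.mpr hm')
  rw [Real.log_div hepos.ne' hs'.ne', Real.log_div hepos.ne' hs.ne', sqrtAbsEval, sqrtAbsEval,
    Real.log_sqrt hN'.le, Real.log_sqrt hN.le]
  rw [show Real.log (e : ℝ) - Real.log ((g.eval (m' : ℤ)).natAbs : ℝ) / 2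
      - (Real.log (e : ℝ) - Real.log ((g.eval (m : ℤ)).natAbs : ℝ) / 2)
      = -((Real.log ((g.eval (m' : ℤ)).natAbs : ℝ) - Real.log ((g.eval (m : ℤ)).natAbs : ℝ)) / 2) by ring,
    abs_neg, abs_div, abs_two]
  field_simp
  ring

/-- **Support of the `m`-difference in `e`, lower end**: if `(e·e^{Δ})² ≤ |g(m)| ≤ |g(m')|` then
`a_e(m) = a_e(m') = 1`, so the difference vanishes (`e ≥ 1`, `Δ > 0`). [this work] -/
theorem locWeight_sub_eq_zero_of_le (g : ℤ[X]) {Δ : ℝ} (hΔ : 0 < Δ) {e m m' : ℕ} (he : 1 ≤ e)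
    (h : ((e : ℝ) * Real.exp Δ) ^ 2 ≤ ((g.eval (m : ℤ)).natAbs : ℝ))
    (hle : (g.eval (m : ℤ)).natAbs ≤ (g.eval (m' : ℤ)).natAbs) :
    locWeight g Δ e m' - locWeight g Δ e m = 0 := by
  rw [locWeight_eq_one g hΔ he h, locWeight_eq_one g hΔ he (h.trans (by exact_mod_cast hle)), sub_self]

/-- **Support of the `m`-difference in `e`, upper end**: if `|g(m)| ≤ |g(m')| ≤ e²·e^{−2Δ}` then
`a_e(m) = a_e(m') = 0` (`g(m), g(m') ≠ 0`, `Δ > 0`). [this work] -/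
theorem locWeight_sub_eq_zero_of_ge (g : ℤ[X]) {Δ : ℝ} (hΔ : 0 < Δ) {e m m' : ℕ}
    (hm : g.eval (m : ℤ) ≠ 0) (hm' : g.eval (m' : ℤ) ≠ 0)
    (h : ((g.eval (m' : ℤ)).natAbs : ℝ) * (Real.exp Δ) ^ 2 ≤ (e : ℝ) ^ 2)
    (hle : (g.eval (m : ℤ)).natAbs ≤ (g.eval (m' : ℤ)).natAbs) :
    locWeight g Δ e m' - locWeight g Δ e m = 0 := by
  have h' : ((g.eval (m : ℤ)).natAbs : ℝ) * (Real.exp Δ) ^ 2 ≤ (e : ℝ) ^ 2 :=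
    le_trans (mul_le_mul_of_nonneg_right (by exact_mod_cast hle) (by positivity)) h
  rw [locWeight_eq_zero g hΔ hm' h, locWeight_eq_zero g hΔ hm h', sub_self]

end Summit.Parity.BatemanHorn.Theorems
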